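import Literature.NumberTheory.Automorphic.GL3UpperUnipotentTwistedConjugation
import HarnessLib

/-!
# Orbital integrals of `GL₃(F)` at regular diagonal elements: descent to the split torus,
# `∫_{G ⧸ A} F(y γ y⁻¹) = C · ∏_{i<j} ‖1 - t_i/t_j‖_F⁻¹ · ∫_{K × N} F(k (n γ) k⁻¹)`

Topic `NumberTheory/Automorphic`; namespace `Literature.NumberTheory.Automorphic`. KERNEL
mathematics only: theorems, no definition, no named fact, no instance, no `sorry`. Road «D-S1»,
letter D-S1f (Rogawski 1990, §4.13, Lemma 4.13.1: `Φ^G(γ, f) = |D_{G/A}(γ)|^{-1/2} δ_B(γ)^{1/2} · f̄^B`-type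
descent for a regular split `γ`): `G = GL₃(F)`, `A` the diagonal torus (`standardLeviGL F id`, free
`A` with `hA`), `N = N₃` the upper unitriangular group, `K = GL₃(𝒪)`, `γ = diag(t₀, t₁, t₂)` with
pairwise distinct entries. Assembly of the torus Iwasawa form of invariant measures on `G ⧸ A`
(`GLnUnipotentRadicalUnimodular.exists_quotientMeasure_torus_eq_smul_map`: `μ = C • ((k,n) ↦ k n A)_*(κ ⊗ μ_N)`)
with the unipotent substitution on `N₃` (`GL3UpperUnipotentTwistedConjugation`).

* `det_one_sub_boxAd_glDiagonal_fin_three` — for the parabolic of type `(2,1)`: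
  `det(1 - K_γ) = (1 - t₀/t₂)(1 - t₁/t₂)` (so `≠ 0` iff `t₀ ≠ t₂`, `t₁ ≠ t₂`).
* `exists_lintegral_descConj_diagonal_eq_mul` — **ONE `C ∈ (0, ∞)` with
  `∫⁻_{G ⧸ A} F(y γ y⁻¹) dμ = C ‖(1 - t₀/t₁)(1 - t₀/t₂)(1 - t₁/t₂)‖_F⁻¹ ∫⁻_{K × N₃} F(k (n γ) k⁻¹) d(κ ⊗ μ_N)`**
  for every Borel `F ≥ 0` and every regular diagonal `γ` (the Jacobian is
  `|D_{G/A}(γ)|^{-1/2} δ_B(γ)^{-1/2}`-normalised: `∏_{i<j} ‖1 - t_i/t_j‖⁻¹ = ∏_{i<j}‖t_i - t_j‖⁻¹ · ‖t₁ t₂²‖`).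

## References

* [Rogawski1990] J. D. Rogawski, *Automorphic Representations of Unitary Groups in Three Variables*
  (1990), §4.13, Lemma 4.13.1 and proof, pp. 69–70.
* [Gelbart1975] S. Gelbart, *Automorphic forms on adele groups* (1975), Thm. 9.22 (iii), Remark 9.23.
-/

noncomputable section

open scoped MatrixGroups NNReal ENNReal
open MeasureTheory Measure Matrix Topology

namespace Literature.NumberTheory.Automorphic

open Literature.MeasureTheory.Group
open Literature.NumberTheory.GaloisRepresentations.IsNonarchimedeanLocalField

/-! ### The Jacobian of the `(2,1)` box at a diagonal element -/

section Det

variable {R : Type*} [CommRing R]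

/-- **`det(1 - K_γ) = (1 - t₀/t₂)(1 - t₁/t₂)`** for `GL₃`, the standard parabolic of type `(2,1)`
and the diagonal `γ = diag(t₀, t₁, t₂)` (`boxAd_glDiagonal`: `K_γ = diag(t₀/t₂, t₁/t₂)`).
[cite: Rogawski1990, §4.13, proof of Lemma 4.13.1, p. 70] -/
theorem det_one_sub_boxAd_glDiagonal_fin_three (t : Fin 3 → Rˣ)
    (hP : glDiagonal 3 R t ∈ standardParabolicGL R ![false, false, true]) :
    (1 - Matrix.of fun q q' : {i : Fin 3 // ![false, false, true] i = false} ×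
        {j : Fin 3 // ![false, false, true] j = true} =>
      (((⟨glDiagonal 3 R t, hP⟩ : standardParabolicGL R ![false, false, true]) : GL (Fin 3) R) :
          Matrix (Fin 3) (Fin 3) R) q.1 q'.1 *
        ((((⟨glDiagonal 3 R t, hP⟩ : standardParabolicGL R ![false, false, true])⁻¹ :
          standardParabolicGL R ![false, false, true]) : GL (Fin 3) R) : Matrix (Fin 3) (Fin 3) R)
            q'.2 q.2).det =
      (1 - (t 0 : R) * (((t 2)⁻¹ : Rˣ) : R)) * (1 - (t 1 : R) * (((t 2)⁻¹ : Rˣ) : R)) := by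
  rw [boxAd_glDiagonal, ← Matrix.diagonal_one, Matrix.diagonal_sub, Matrix.det_diagonal]
  change ∏ q : {i : Fin 3 // ![false, false, true] i = false} × {j : Fin 3 // ![false, false, true] j = true},
      ((1 : R) - (t q.1 : R) * (((t q.2)⁻¹ : Rˣ) : R)) = _
  rw [Fintype.prod_prod_type]
  have htrue : ∀ x : Fin 3, x ∈ ({2} : Finset (Fin 3)) ↔ ![false, false, true] x = true := by decide
  have hfalse : ∀ x : Fin 3, x ∈ ({0, 1} : Finset (Fin 3)) ↔ ![false, false, true] x = false := by
    decide
  have hinner : ∀ a : {i : Fin 3 // ![false, false, true] i = false},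
      ∏ b : {j : Fin 3 // ![false, false, true] j = true}, ((1 : R) - (t a : R) * (((t b)⁻¹ : Rˣ) : R)) =
        1 - (t a : R) * (((t 2)⁻¹ : Rˣ) : R) := by
    intro a
    rw [show (∏ b : {j : Fin 3 // ![false, false, true] j = true},
        ((1 : R) - (t a : R) * (((t b)⁻¹ : Rˣ) : R))) =
        ∏ j ∈ ({2} : Finset (Fin 3)), ((1 : R) - (t a : R) * (((t j)⁻¹ : Rˣ) : R)) from
      (Finset.prod_subtype _ htrue (fun j : Fin 3 => (1 : R) - (t a : R) * (((t j)⁻¹ : Rˣ) : R))).symm,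
      Finset.prod_singleton]
  simp_rw [hinner]
  rw [show (∏ a : {i : Fin 3 // ![false, false, true] i = false},
      ((1 : R) - (t a : R) * (((t 2)⁻¹ : Rˣ) : R))) =
      ∏ i ∈ ({0, 1} : Finset (Fin 3)), ((1 : R) - (t i : R) * (((t 2)⁻¹ : Rˣ) : R)) from
    (Finset.prod_subtype _ hfalse (fun i : Fin 3 => (1 : R) - (t i : R) * (((t 2)⁻¹ : Rˣ) : R))).symm,
    Finset.prod_pair (by decide)]

end Det

/-! ### The orbital integrand at a regular diagonal element, in `K × N` coordinates -/

section Torus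

variable (F : Type*) [Field F] [ValuativeRel F] [TopologicalSpace F] [IsNonarchimedeanLocalField F]
  [MeasurableSpace F] [BorelSpace F] [MeasurableSpace (GL (Fin 3) F)] [BorelSpace (GL (Fin 3) F)]

/-- **Descent of the orbital integrand of `GL₃(F)` at a regular diagonal element to `K × N`**
(Rogawski 1990, Lemma 4.13.1 and its proof; Gelbart 1975, Thm. 9.22 (iii)): for `A` the diagonal
torus (`hA`), a non-zero `G`-invariant Radon measure `μ` on `G ⧸ A`, Haar measures `κ` on
`K = GL₃(𝒪)` and `μ_N` on `N = N₃`, there is ONE constant `C ∈ (0, ∞)` such that for every diagonal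
`γ = diag(t₀, t₁, t₂) ∈ A` with pairwise distinct entries and every Borel `F : GL₃(F) → [0, ∞]`:
**`∫⁻_{G ⧸ A} F(y γ y⁻¹) dμ(y) = C · ‖(1-t₀/t₁)(1-t₀/t₂)(1-t₁/t₂)‖_F⁻¹ · ∫⁻_{K × N} F(k (n γ) k⁻¹) d(κ ⊗ μ_N)`.**
[cite: Rogawski1990, §4.13, Lemma 4.13.1 (a), pp. 69–70] -/
theorem exists_lintegral_descConj_diagonal_eq_mul
    {A : Subgroup (GL (Fin 3) F)} (hA : A = standardLeviGL F (id : Fin 3 → Fin 3))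
    [MeasurableSpace (GL (Fin 3) F ⧸ A)] [BorelSpace (GL (Fin 3) F ⧸ A)]
    (μ : Measure (GL (Fin 3) F ⧸ A)) [SMulInvariantMeasure (GL (Fin 3) F) (GL (Fin 3) F ⧸ A) μ]
    [IsFiniteMeasureOnCompacts μ] (hμ : μ ≠ 0)
    (κ : Measure ↥(glInt 3 F)) [IsHaarMeasure κ]
    (μN : Measure ↥(unipotentRadicalGL F (id : Fin 3 → Fin 3))) [IsHaarMeasure μN] :
    ∃ C : ℝ≥0∞, C ≠ 0 ∧ C ≠ ∞ ∧ ∀ (t : Fin 3 → Fˣ) (_h01 : (t 0 : F) ≠ t 1) (_h02 : (t 0 : F) ≠ t 2)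
      (_h12 : (t 1 : F) ≠ t 2) (hγA : ∀ a ∈ A, a * glDiagonal 3 F t = glDiagonal 3 F t * a)
      (Fn : GL (Fin 3) F → ℝ≥0∞), Measurable Fn →
        ∫⁻ y, descConj (glDiagonal 3 F t) A hγA Fn y ∂μ =
          C * ((normAbs F ((1 - (t 0 : F) * (t 1 : F)⁻¹) * ((1 - (t 0 : F) * (t 2 : F)⁻¹) *
              (1 - (t 1 : F) * (t 2 : F)⁻¹)))⁻¹ : ℝ≥0) : ℝ≥0∞) *
            ∫⁻ q : ↥(glInt 3 F) × ↥(unipotentRadicalGL F (id : Fin 3 → Fin 3)),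
              Fn ((q.1 : GL (Fin 3) F) * ((q.2 : GL (Fin 3) F) * glDiagonal 3 F t) *
                (q.1 : GL (Fin 3) F)⁻¹) ∂(κ.prod μN) := by
  classical
  haveI : T2Space F := (isLocalField F).toT2Space
  haveI : SecondCountableTopology F := secondCountableTopology_localField F
  haveI : LocallyCompactSpace F := (isLocalField F).toLocallyCompactSpace
  haveI : SecondCountableTopology (Matrix (Fin 3) (Fin 3) F) :=
    inferInstanceAs (SecondCountableTopology (Fin 3 → Fin 3 → F))
  haveI : SecondCountableTopology (Matrix (Fin 3) (Fin 3) F)ᵐᵒᵖ :=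
    MulOpposite.opHomeomorph.symm.secondCountableTopology
  haveI : SecondCountableTopology (GL (Fin 3) F) :=
    Units.isEmbedding_embedProduct.secondCountableTopology
  haveI : LocallyCompactSpace (Matrix (Fin 3) (Fin 3) F) :=
    inferInstanceAs (LocallyCompactSpace (Fin 3 → Fin 3 → F))
  haveI : SecondCountableTopology ↥(glInt 3 F) := TopologicalSpace.Subtype.secondCountableTopology _
  haveI : SecondCountableTopology ↥(unipotentRadicalGL F (id : Fin 3 → Fin 3)) :=
    TopologicalSpace.Subtype.secondCountableTopology _
  haveI : BorelSpace ↥(glInt 3 F) := Subtype.borelSpace _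
  haveI : BorelSpace ↥(unipotentRadicalGL F (id : Fin 3 → Fin 3)) := Subtype.borelSpace _
  haveI : BorelSpace (↥(glInt 3 F) × ↥(unipotentRadicalGL F (id : Fin 3 → Fin 3))) := Prod.borelSpace
  haveI : LocallyCompactSpace ↥(unipotentRadicalGL F (id : Fin 3 → Fin 3)) :=
    (isClosed_unipotentRadicalGL (id : Fin 3 → Fin 3)).locallyCompactSpace
  haveI : SFinite μN := inferInstance
  haveI : CompactSpace ↥(glInt 3 F) := isCompact_iff_compactSpace.1 (isCompact_glInt 3 F)
  haveI : IsFiniteMeasure κ := CompactSpace.isFiniteMeasure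
  obtain ⟨C, hC, hμC⟩ := exists_quotientMeasure_torus_eq_smul_map F hA μ hμ κ μN
  refine ⟨C, ENNReal.coe_ne_zero.2 hC, ENNReal.coe_ne_top, fun t h01 h02 h12 hγA Fn hFn => ?_⟩
  -- the diagonal element as an element of the parabolic of type `(2,1)`
  have hmono : Monotone (![false, false, true] : Fin 3 → Bool) := by decide
  have hP : glDiagonal 3 F t ∈ standardParabolicGL F ![false, false, true] := by
    rw [mem_standardParabolicGL_iff, coe_glDiagonal]; exact Matrix.blockTriangular_diagonal _
  have hdet := det_one_sub_boxAd_glDiagonal_fin_three (R := F) t hP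
  have hK : (1 - Matrix.of fun q q' : {i : Fin 3 // ![false, false, true] i = false} ×
        {j : Fin 3 // ![false, false, true] j = true} =>
      (((⟨glDiagonal 3 F t, hP⟩ : standardParabolicGL F ![false, false, true]) : GL (Fin 3) F) :
          Matrix (Fin 3) (Fin 3) F) q.1 q'.1 *
        ((((⟨glDiagonal 3 F t, hP⟩ : standardParabolicGL F ![false, false, true])⁻¹ :
          standardParabolicGL F ![false, false, true]) : GL (Fin 3) F) : Matrix (Fin 3) (Fin 3) F)
            q'.2 q.2).det ≠ 0 := by
    rw [hdet]
    refine mul_ne_zero (sub_ne_zero.2 fun h => h02 ?_) (sub_ne_zero.2 fun h => h12 ?_)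
    · have := congrArg (fun x : F => x * (t 2 : F)) h
      simpa [mul_assoc] using this.symm
    · have := congrArg (fun x : F => x * (t 2 : F)) h
      simpa [mul_assoc] using this.symm
  -- (1) the quotient measure in `K × N` coordinates
  have hπ : Measurable fun q : ↥(glInt 3 F) × ↥(unipotentRadicalGL F (id : Fin 3 → Fin 3)) =>
      (QuotientGroup.mk ((q.1 : GL (Fin 3) F) * (q.2 : GL (Fin 3) F)) : GL (Fin 3) F ⧸ A) :=
    ((QuotientGroup.continuous_mk (N := A)).comp ((continuous_subtype_val.comp continuous_fst).mul
      (continuous_subtype_val.comp continuous_snd))).measurable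
  have hf : Measurable (descConj (glDiagonal 3 F t) A hγA Fn) := measurable_descConj _ _ _ hFn
  rw [hμC, lintegral_smul_measure, lintegral_map hf hπ]
  simp only [descConj_mk]
  -- (2) Tonelli and the substitution on `N` for each `k`
  have hjoint : Measurable fun q : ↥(glInt 3 F) × ↥(unipotentRadicalGL F (id : Fin 3 → Fin 3)) =>
      Fn ((q.1 : GL (Fin 3) F) * (q.2 : GL (Fin 3) F) * glDiagonal 3 F t *
        ((q.1 : GL (Fin 3) F) * (q.2 : GL (Fin 3) F))⁻¹) :=
    hFn.comp ((((continuous_subtype_val.comp continuous_fst).mul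
      (continuous_subtype_val.comp continuous_snd)).mul continuous_const).mul
      ((continuous_subtype_val.comp continuous_fst).mul
        (continuous_subtype_val.comp continuous_snd)).inv).measurable
  have hjoint' : Measurable fun q : ↥(glInt 3 F) × ↥(unipotentRadicalGL F (id : Fin 3 → Fin 3)) =>
      Fn ((q.1 : GL (Fin 3) F) * ((q.2 : GL (Fin 3) F) * glDiagonal 3 F t) * (q.1 : GL (Fin 3) F)⁻¹) :=
    hFn.comp (((continuous_subtype_val.comp continuous_fst).mul
      ((continuous_subtype_val.comp continuous_snd).mul continuous_const)).mul
      (continuous_subtype_val.comp continuous_fst).inv).measurable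
  rw [lintegral_prod _ hjoint.aemeasurable, lintegral_prod _ hjoint'.aemeasurable]
  have hinner : ∀ k : ↥(glInt 3 F),
      ∫⁻ n : ↥(unipotentRadicalGL F (id : Fin 3 → Fin 3)),
          Fn ((k : GL (Fin 3) F) * (n : GL (Fin 3) F) * glDiagonal 3 F t *
            ((k : GL (Fin 3) F) * (n : GL (Fin 3) F))⁻¹) ∂μN =
        ((normAbs F ((1 - (t 0 : F) * (t 1 : F)⁻¹) * ((1 - (t 0 : F) * (t 2 : F)⁻¹) *
            (1 - (t 1 : F) * (t 2 : F)⁻¹)))⁻¹ : ℝ≥0) : ℝ≥0∞) *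
          ∫⁻ n : ↥(unipotentRadicalGL F (id : Fin 3 → Fin 3)),
            Fn ((k : GL (Fin 3) F) * ((n : GL (Fin 3) F) * glDiagonal 3 F t) *
              (k : GL (Fin 3) F)⁻¹) ∂μN := by
    intro k
    have hφk : Measurable fun g : GL (Fin 3) F => Fn ((k : GL (Fin 3) F) * g * (k : GL (Fin 3) F)⁻¹) :=
      hFn.comp ((continuous_const.mul continuous_id).mul continuous_const).measurable
    have h := lintegral_upperUnitriangular_three_conj_diagonal_eq_mul F t h01
      ⟨glDiagonal 3 F t, hP⟩ rfl hK μN _ hφk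
    have hlhs : ∀ n : ↥(unipotentRadicalGL F (id : Fin 3 → Fin 3)),
        Fn ((k : GL (Fin 3) F) * (n : GL (Fin 3) F) * glDiagonal 3 F t *
            ((k : GL (Fin 3) F) * (n : GL (Fin 3) F))⁻¹) =
          Fn ((k : GL (Fin 3) F) * ((n : GL (Fin 3) F) * glDiagonal 3 F t * (n : GL (Fin 3) F)⁻¹) *
            (k : GL (Fin 3) F)⁻¹) := fun n => by
      congr 1; simp only [_root_.mul_inv_rev]; group
    simp_rw [hlhs]
    rw [h, hdet]
    congr 2
    rw [← map_mul, ← mul_inv]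
    congr 2
    simp only [Units.val_inv_eq_inv_val]
    ring
  simp_rw [hinner]
  rw [lintegral_const_mul' _ _ ENNReal.coe_ne_top, ENNReal.smul_def, smul_eq_mul, ← mul_assoc]

end Torus

end Literature.NumberTheory.Automorphic
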